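import Summits.ResolutionOfSingularities.ResolutionOfSingularities.Theorems.TightCutPoverty
import Summits.ResolutionOfSingularities.ResolutionOfSingularities.Theorems.MaxContactCutItineraryCut
import Summits.ResolutionOfSingularities.ResolutionOfSingularities.Theorems.BoundaryLedgerClasses
import Summits.ResolutionOfSingularities.ResolutionOfSingularities.Theorems.MaxContactCutExponentLadder
import Summits.ResolutionOfSingularities.ResolutionOfSingularities.Theorems.NoJump
import Summits.ResolutionOfSingularities.ResolutionOfSingularities.Theorems.JumpCutClasses
import Summits.ResolutionOfSingularities.ResolutionOfSingularities.Theorems.MaxContactCutExitLaw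
import Summits.ResolutionOfSingularities.ResolutionOfSingularities.Theorems.FloorCutClasses
import Literature.AlgebraicGeometry.Resolution.HasseSchmidtDiffEqDiffOp
import Summits.ResolutionOfSingularities.ResolutionOfSingularities.Theorems.ConeCutAxisLaw
import Summits.ResolutionOfSingularities.ResolutionOfSingularities.Theorems.MaxContactCutPlanarCut
import HarnessLib

/-!
# HoleCutLawJPlus — decomp-res node «HoleCut» (lens-3 g18, critic row 143), tree file 1/4 of the node

Content VERBATIM from the decomp-res lens-3 g18 file `HOME/decomp-res-lens-3/g18/HoleCut.lean` (sha256 55250664…,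
3677 l; = `parts/HoleCut-NODE-55250664.lean`;
HOME = run/shared/lean/pub/decomp-res), NEW sections only: its carried l. 89–3133 are lens-3 g17 TightCut
@7fe2fb69 VERBATIM and ALREADY in the tree as
`Theorems/TightCut*` / `MaxContactCutTightCut` (and the g13–g16 chain below them) — not landed again; the §M
root `closes` (≡ `MaxContactCutExponentLadder.closes`)
is not restated.  Critic: CRITIC-LEDGER row 143 (CLEARED 2026-08-30T20:55:21Z); landing plan NODE-g18 §6.  Landed
by decomp-res writer g7 in the lens's namespace
`…Theorems.HoleCut` with `open …Theorems.TightCut` (the carried decls resolve against the landed TightCut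
files).  Aside budget: the g17 residual 28532
`TightNoJointTailsFromFourDeep` is KEPT as the one booked item and re-informalled with its EXACT two-piece form
`four_iff_hole` (pieces A `NoSubcriticalJointTailsDeep`,
B `NoHoleFillingTailsDeep`, both in the cone-free `HoleCutClasses`), per the critic's budget option.

§J⁺ (l. 3137–3328) LAW J⁺ — THE SHADE-GRADED CORNER LAW `3·corner + s + 3 ≤ 3q` at EVERY shade `s`:
`exists_minimal_index`, `corner_bound_shade`,
`corner_bound_shade_of_stays`, `corner_bound_of_shade` (PROVED, 0 sorry).  Imports the landed `TightCutPoverty` (g17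
chain: face identity / transport lemmas of
`TightCutLawJ2`, `coeff_succ_layer`, `resForm_eq_pow_of_repeat`) and the lens's tree imports.

## The lens's node description (VERBATIM)

## (lens) HoleCut — decomp-res lens 3, generation 18 (RESIDUAL MODE; host route `MaxContactCut`, aside item 31770
`MaxContactCut.DefectWalksDeep`; lens 3 = «one certified translation + split beneath»)

TARGET (tree vocabulary, BY NAME): lens-3 g17's located residual `NoJointTailsFromFourDeep` (`TightCut.lean` g17, pin
7fe2fb69, :2830; carried VERBATIM below, §K3) — the tree's JOINT RESIDUAL of 31770,
`Theorems.ExitLaw.NoRepeatTranslationRecurrentExcessPlateauxDeep` (`Theorems/ExitLawClasses.lean` :171), cut at shades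
`≥ 4` or the modulus `q = 4` (g17 `joint_iff_four`, carried); the tree cut `ExitLaw.defectWalksDeep_iff_joint' :
MaxContactCut.DefectWalksDeep ↔ NoFreePointTailsDeep ∧ (joint residual)` is hypothesis-free.

NODE (window (α) of critic row 136: ONE law PARAMETRIC in the shade).  NoJointTailsFromFourDeep ⟸
NoSubcriticalJointTailsDeep [LOCATED RESIDUAL A: joint tails of shade `s ≥ 3` at a modulus `q = p^e < 3s − 2` — the cell
`(4,3)` and every census cell with `s ≥ 4`; binders VERBATIM + `shade_N = s ∧ 3 ≤ s ∧ p^e + 3 ≤ 3s` · NECESSARY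
`sub_of_four` · UNDECIDED] ∧ NoHoleFillingTailsDeep [LOCATED RESIDUAL B: joint tails of shade `s ≥ 4` at `q ≥
3s − 2` which
fill holes INSIDE THE DEFICIT WINDOW infinitely often; binders VERBATIM + that clause in tree letters · NECESSARY
`hole_of_four` · UNDECIDED]; EXACT `four_iff_hole` (THE ONE CERTIFIED EQUIV); the complement
NoSupercriticalHoleFreeJointTailsDeep
[WINDOW: joint tails of ANY shade `s` at `q ≥ 3s − 2` that eventually never fill a hole · DECIDED — PROVED EMPTY
`noSupercriticalHoleFreeJointTails_holds`, all shades at once]; composed: `three_iff_hole`, `joint_iff_hole :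
ExitLaw.NoRepeatTranslationRecurrentExcessPlateauxDeep ↔ A ∧ B`; 31770 BY NAME `defectWalksDeep_of_hole`, EXACT and
hypothesis-free `defectWalksDeep_iff_hole : MaxContactCut.DefectWalksDeep ↔ NoFreePointTailsDeep ∧ A ∧ B`; root BY NAME
`closes` (VERBATIM g15/g16/g17).

THE NEW LAW (§J⁺, `corner_bound_shade`).  **LAW J⁺ — THE SHADE-GRADED CORNER LAW**: on a plateau `t, t+1, t+2` of shade
`s` with orders `> q` at `t, t+1`, in front of an UNTRANSLATED proximity repeat `t+1` (`j_{t+1} = i ≠ j_t = j`,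
`b_{t+1} = 0`; `k` the third variable) the corner satisfies `3·(r_{t+1}(j) + r_{t+1}(k)) + s + 3 ≤ 3q`, i.e.
`corner ≤ q − 1 − ⌈s/3⌉` — ONE kernel proof for every shade (`s ≤ 3`: LAW J of g16, re-proved; `s =
4,5,6`: `q − 3`;
`s = 7,8,9`: `q − 4`; …; census T-lawJs: consistent on all 986 in-window repeats and TIGHT at `(q,s) = (8,4), (8,5),
(9,4)`).  Proof: the AXIS LAW at `t+1` for `(j,k)` (tree `ConeCutAxisLaw`) gives a monomial `u^{r_{t+1}+μ}` of `F_{t+1}`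
with `μ_j + μ_k ≤ q − 1 − corner`; (A) `μ_j = 0`: the face identity at the layer `o_t` and the POWER LAW force
`μ_k ≥ s`; (B) `b := μ_j ≥ 1`: the FACE IDENTITY AT THE LAYER `o_t + b` (g17 `coeff_succ_layer`) makes the `u_j`-slice
`b` of `F_{t+1}` above the boundary the Cauchy product `U_t · N_t(o_t + b)`, `U_t(0) ≠ 0`; a COMPONENTWISE-MINIMAL index
`ν*` of `N_t(o_t + b)` below `μ` (`exists_minimal_index`) is a monomial of `F_{t+1}` with `|ν*| ≤ s + b` (layer degree,
g15 `degree_le_of_coeff_translate_resLayer_ne_zero`) and `ν*_k ≤ μ_k`; its `u_j`-exponent `r_{t+1}(j) + b` lies in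
`(0, q)`, so it survives the untranslated move `t+1` uncleaned, and the PLATEAU AT `t+2` gives `ν*_i + 2b + 2ν*_k ≥ 2s`;
hence `s ≤ 3b + ν*_k ≤ 3(q − 1 − corner)`.

THE PARAMETRIC POVERTY LEDGER (§P₊, `TailShade`).  On a shade-`s` tail with positive excess, `q ≥ 3s − 2`: a stage is
POOR if a boundary coordinate vanishes (a lost exceptional component); translations create poverty (P2), poverty
propagates through every move except a HOLE-FILLING one — an untranslated chart change INTO the vanished coordinate
(`HoleFill`; P3₊ `hasZero_succ_or_holeFill`) — and a proximity repeat between two poor stages IS hole-filling (P4₊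
`holeFill_of_repeat`: otherwise the kept mass is at most the newest mass `≤ s − 1` and `D ≤ 2s − 2 < q + 1 − s` two
moves on).  REDUCTION `exists_holeFill`: a supercritical joint tail fills holes infinitely often; DEFICIT WINDOW
`holeFill_window`: at a hole-filling move the corner `= D_{u+1}` satisfies `q + 1 − s ≤ corner` (ledger) and
`3·corner + s + 3 ≤ 3q` (LAW J⁺) — at `s = 4` exactly `corner = q − 3` (`holeFill_corner_four`), the analogue of g17's
TIGHT corner `q − 2` at `s = 3` (where LAW J₂ closes it).

CARRIED VERBATIM (credited, DELETE ON LANDING): lines 89–3133 below = g17 `TightCut.lean` (pin 7fe2fb69) lines 90–3134 —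
its §V1/§V2 (= g15 `ConeCut.lean` rev 5 walk arithmetic and cone calculus, now landing as `Theorems/ConeCut*`),
§J/§S/§K/§L
(g16 `ShadeCut.lean` d031e7e4: LAW J, the shade-two theorem, booking; landing as `Theorems/ShadeCut*`), §J₂/§P/§K3/§L4/§N
(g17: LAW J₂, the shade-three theorem, booking, conjunction class with lens-5).  NEW in g18 (from l. 3137):
§J⁺, §P₊, §K4,
and §M `closes` VERBATIM.  Imports are tree-only (exactly g17's eleven); no HOME file is imported;
`allowUnsafeReducibility` is not used; 0 sorry.

[WRITER NOTE (decomp-res writer g7): section split only; every declaration as in the lens except: the lens's private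
`eq_of_le_of_degree_le` (a `Fin 3` copy of the
tree's `ExitLaw.eq_of_le_of_degree_le`, opened here) is not restated; `chartExponent_of_ne` ↦ the landed
`ProximityCut.chartExponent_apply_ne` and `exists_third a b h` ↦
`ConeCut.exists_third h` exactly as in the landed TightCut files; global `set_option` dropped.]

(Sources: CossartPiltant2008 Prop. 4.2; CossartPiltant2009; CossartJannsenSaito2020; Hauser2010; Moh1987;
BenitoVillamayor2012; HauserPerlega2024.)
-/

noncomputable section

open MvPolynomial Finset
open Literature.AlgebraicGeometry.Resolution
open Literature.AlgebraicGeometry.Resolution.Hauser2010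
open Literature.AlgebraicGeometry.Resolution.PointBlowup
open Summit.ResolutionOfSingularities.ResolutionOfSingularities.Theses
open Summit.ResolutionOfSingularities.ResolutionOfSingularities.Theorems.TightDefectClasses
open Summit.ResolutionOfSingularities.ResolutionOfSingularities.Theorems.TightDefectStrongWalks
open Summit.ResolutionOfSingularities.ResolutionOfSingularities.Theorems.ItineraryCutClasses
open Summit.ResolutionOfSingularities.ResolutionOfSingularities.Theorems.BoundaryLedger
open Summit.ResolutionOfSingularities.ResolutionOfSingularities.Theorems.ProximityCut
open Summit.ResolutionOfSingularities.ResolutionOfSingularities.Theorems.ConeCutAxisLaw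
open Literature.AlgebraicGeometry.Resolution.WeightedBlowup
open Literature.Barriers.ResolutionOfSingularities
open Summit.ResolutionOfSingularities.ResolutionOfSingularities.Theorems.FloorCut
open Summit.ResolutionOfSingularities.ResolutionOfSingularities.Theorems.ConeCut
open Summit.ResolutionOfSingularities.ResolutionOfSingularities.Theorems.ExitLaw (fin3_cases eq_of_le_of_degree_le)
open Summit.ResolutionOfSingularities.ResolutionOfSingularities.Theorems.ShadeCut
open Summit.ResolutionOfSingularities.ResolutionOfSingularities.Theorems.TightCut

namespace Summit.ResolutionOfSingularities.ResolutionOfSingularities.Theorems.HoleCut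

/-! ═════════════════════════  NEW (g18): §J⁺ the shade-graded
corner law · §P₊ the parametric poverty ledger ·
§K4 booking (hole-filling tails)  ═════════════════════════ -/
/-! ## §J⁺  LAW J⁺ — THE SHADE-GRADED CORNER LAW (new, g18): `3·corner + s + 3 ≤ 3q` at EVERY shade `s`

LAW J (g16) bounds the corner `r_{t+1}(j_t) + r_{t+1}(k)` in front of an untranslated proximity repeat by `q − 2`, at
every shade; at shades `s ≥ 4` the census shows the true ceiling is lower.  LAW J⁺ is ONE law for all shades:
`corner ≤ q − 1 − ⌈s/3⌉` (`= q − 2` for `s ≤ 3`, `q − 3` for `s = 4,5,6`, `q − 4` for `s = 7,8,9`,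
…).  PROOF.  The AXIS
LAW at `t+1` for the pair `(j_t, k)` gives a monomial `u^{r_{t+1}+μ}` of `F_{t+1}` with `μ_j + μ_k ≤ q − 1 − corner`.
(A) `μ_j = 0`: the face identity at the layer `o_t` and the POWER LAW (`N_t = c·u_k^s`) force `μ_k ≥ s`.  (B) `b :=
μ_j ≥ 1`: the FACE IDENTITY AT THE LAYER `o_t + b` (`coeff_succ_layer`, g17) writes the `u_j`-slice `b` of `F_{t+1}`
above the boundary as the Cauchy product `U_t · N_t(o_t + b)`; a COMPONENTWISE-MINIMAL index `ν*` of `N_t(o_t+b)`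
below `μ` carries `U_t(0)·coeff ≠ 0`, has `|ν*| ≤ s + b` (layer degree) and `ν*_k ≤ μ_k`; the PLATEAU AT `t+2` read
through the untranslated move `t+1` (chart `i`; the `u_j`-exponent `r_{t+1}(j) + b` lies strictly between `0` and
`q`, so the chart image is not cleaned away) forces `ν*_i + 2b + 2ν*_k ≥ 2s`; together `s ≤ 3b + ν*_k ≤ 3(b + μ_k) ≤
3(q − 1 − corner)`.  Consistent with census T-lawJs on all 986 in-window repeats and TIGHT at (q,s) = (8,4), (8,5),
(9,4). -/
section LawJPlus

variable {K : Type} [Field K] [DecidableEq K] {q : ℕ} {s₀ : State (Fin 3) K}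

/-- **Minimal index of a Cauchy product with a unit constant term (PROVED).**  If `coeff_ν (U · T) ≠ 0` there is an
exponent `ν* ≤ ν` in the support of `T`, componentwise minimal there, so that `coeff_{ν*} (U · T) = U(0)·coeff_{ν*} T`;
with `U(0) ≠ 0` it is a witness of `U · T`. [folklore] -/
theorem exists_minimal_index (U T : MvPolynomial (Fin 3) K) (hU : coeff 0 U ≠ 0) {ν : Fin 3 →₀ ℕ}
    (h : coeff ν (U * T) ≠ 0) :
    ∃ νm : Fin 3 →₀ ℕ, νm ≤ ν ∧ coeff νm T ≠ 0 ∧ coeff νm (U * T) ≠ 0 := by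
  classical
  rw [coeff_mul] at h
  obtain ⟨x, hx, hne⟩ := Finset.exists_ne_zero_of_sum_ne_zero h
  have hsum : x.1 + x.2 = ν := Finset.HasAntidiagonal.mem_antidiagonal.mp hx
  have hx2 : x.2 ≤ ν := by rw [← hsum]; exact le_add_self
  have hT2 : coeff x.2 T ≠ 0 := right_ne_zero_of_mul hne
  set S := T.support.filter (fun y => y ≤ ν) with hS
  have hSne : S.Nonempty := ⟨x.2, Finset.mem_filter.mpr ⟨mem_support_iff.mpr hT2, hx2⟩⟩
  obtain ⟨νm, hνm, hmin⟩ := Finset.exists_min_image S (fun y => y.degree) hSne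
  obtain ⟨hνmT, hνmν⟩ := Finset.mem_filter.mp hνm
  refine ⟨νm, hνmν, mem_support_iff.mp hνmT, ?_⟩
  rw [coeff_mul, Finset.sum_eq_single ((0 : Fin 3 →₀ ℕ), νm)]
  · exact mul_ne_zero hU (mem_support_iff.mp hνmT)
  · intro z hz hzne
    have hzsum : z.1 + z.2 = νm := Finset.HasAntidiagonal.mem_antidiagonal.mp hz
    have hz2 : z.2 ≤ νm := by rw [← hzsum]; exact le_add_self
    by_cases hzT : coeff z.2 T = 0
    · rw [hzT, mul_zero]
    · exfalso
      have hz2S : z.2 ∈ S := Finset.mem_filter.mpr ⟨mem_support_iff.mpr hzT, hz2.trans hνmν⟩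
      have heq : z.2 = νm := eq_of_le_of_degree_le hz2 (hmin z.2 hz2S)
      have hz1 : z.1 = 0 := by
        rw [heq] at hzsum
        exact add_right_cancel (hzsum.trans (zero_add _).symm)
      exact hzne (Prod.ext hz1 heq)
  · intro hnot
    exact absurd (Finset.HasAntidiagonal.mem_antidiagonal.mpr (zero_add _)) hnot

/-- **LAW J⁺ — THE SHADE-GRADED CORNER LAW (PROVED).**  Plateau `t → t+1 → t+2` of shade `n` from orders
`o_t, o_{t+1} > q`; move `t+1` an UNTRANSLATED proximity repeat (`j_{t+1} ≠ j_t`, `b_{t+1} = 0`); `k` the third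
variable.  Then `3·(r_{t+1}(j_t) + r_{t+1}(k)) + n + 3 ≤ 3q` — the corner is at most `q − 1 − ⌈n/3⌉`. [new] -/

theorem corner_bound_shade (hroot : IsRoot q s₀) (W : ForcedWalk q s₀) (t : ℕ) {o₀ o₁ : ℕ}
    (ho₀ : ordZero (W.st t).F = o₀) (ho₁ : ordZero (W.st (t + 1)).F = o₁) (hq0 : q < o₀) (hq1 : q < o₁)
    (hplat : (W.st (t + 1)).shade = (W.st t).shade) (hplat' : (W.st (t + 2)).shade = (W.st (t + 1)).shade)
    {n : ℕ} (hn : (W.st t).shade = (n : ℕ∞)) (hne : W.j (t + 1) ≠ W.j t) (hb : W.b (t + 1) = 0)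
    {k : Fin 3} (hki : k ≠ W.j (t + 1)) (hkj : k ≠ W.j t) :
    3 * ((W.st (t + 1)).r (W.j t) + (W.st (t + 1)).r k) + n + 3 ≤ 3 * q := by
  classical
  have hS : W.j (t + 1) ≠ W.j t ∧ W.b (t + 1) (W.j t) = 0 := ⟨hne, by rw [hb]; rfl⟩
  have hbk : W.b (t + 1) k = 0 := by rw [hb]; rfl
  -- orders and ledgers
  obtain ⟨p₀, hp₀, -, h02⟩ := NoJump.order_lt_two_mul hroot W t
  have e0 : p₀ = o₀ := by have := hp₀.symm.trans ho₀; exact_mod_cast this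
  subst e0
  obtain ⟨o₂, ho₂, -, -⟩ := NoJump.order_lt_two_mul hroot W (t + 2)
  have hn1 : (W.st (t + 1)).shade = (n : ℕ∞) := hplat.trans hn
  have hn2 : (W.st (t + 2)).shade = (n : ℕ∞) := hplat'.trans hn1
  have hod0 : p₀ = n + (W.st t).r.degree := order_eq_of_plateau hroot W ho₀ hn
  have hod1 : o₁ = n + (W.st (t + 1)).r.degree := order_eq_of_plateau hroot W ho₁ hn1
  have hod2 : o₂ = n + (W.st (t + 2)).r.degree := order_eq_of_plateau hroot W ho₂ hn2
  have hr₁ : (W.st (t + 1)).r = kept W t + Finsupp.single (W.j t) (p₀ - q) := r_succ_eq W t ho₀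
  have hr₁j : (W.st (t + 1)).r (W.j t) = p₀ - q := NoJump.r_succ_chart W t ho₀
  have hr₁deg : (W.st (t + 1)).r.degree = (kept W t).degree + (p₀ - q) := degree_r_succ W t ho₀
  have hdeg2 : (W.st (t + 2)).r.degree = (kept W (t + 1)).degree + (o₁ - q) := degree_r_succ W (t + 1) ho₁
  have hkept1 : (kept W (t + 1)).degree + (W.st (t + 1)).r (W.j (t + 1)) = (W.st (t + 1)).r.degree :=
    kept_degree_of_untranslated W (t + 1) hb
  -- the AXIS LAW at `t+1` for the pair `(j_t, k)`: a monomial `u^{r_{t+1} + μ}` with `μ_j + μ_k + corner < q`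
  obtain ⟨m, hm, hlt⟩ := exists_support_pair_lt_of_isolatedTop (W.isolated (t + 1)) (W.j t) k hkj.symm
  have hrm : (W.st (t + 1)).r ≤ m := walk_r hroot W (t + 1) m hm
  obtain ⟨μ, rfl⟩ : ∃ μ, m = (W.st (t + 1)).r + μ := ⟨_, (add_tsub_cancel_of_le hrm).symm⟩
  rw [Finsupp.add_apply, Finsupp.add_apply] at hlt
  by_cases hμj0 : μ (W.j t) = 0
  · -- (A) on the `u_j`-face: the POWER LAW (`β = 0`) and the face identity at the layer `o_t` force `μ_k ≥ n`
    obtain ⟨c, -, hpow⟩ := resForm_eq_pow_of_repeat hroot W t ho₀ ho₁ hq0 hq1 hplat hplat' hn hS hki hkj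
    rw [hbk, map_zero, zero_mul, sub_zero] at hpow
    have hcoef : coeff ((W.st (t + 1)).r + μ) (W.st (t + 1)).F ≠ 0 := mem_support_iff.mp hm
    have hr : (W.st (t + 1)).r + μ = kept W t + μ + Finsupp.single (W.j t) (p₀ - q) := by
      rw [hr₁, add_right_comm]
    rw [hr, coeff_succ_layer hroot W t hq0 h02 hμj0, hpow, X_pow_eq_monomial, C_mul_monomial, mul_one,
      coeff_mul_monomial'] at hcoef
    split_ifs at hcoef with hle
    · have a3 := Finsupp.le_def.mp hle k
      rw [Finsupp.single_eq_same] at a3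
      omega
    · exact absurd rfl hcoef
  · -- (B) off the face: `b := μ_j ≥ 1`; split `μ = ν + b e_j` with `ν` off `u_j`
    have hbpos : 1 ≤ μ (W.j t) := Nat.one_le_iff_ne_zero.mpr hμj0
    set b := μ (W.j t) with hb_def
    set ν := Finsupp.erase (W.j t) μ with hν_def
    have hνj : ν (W.j t) = 0 := Finsupp.erase_same
    have hνk : ν k = μ k := Finsupp.erase_ne hkj
    have hνi : ν (W.j (t + 1)) = μ (W.j (t + 1)) := Finsupp.erase_ne hne
    have hμeq : μ = ν + Finsupp.single (W.j t) b := by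
      ext l
      by_cases hl : l = W.j t
      · rw [hl, Finsupp.add_apply, hνj, Finsupp.single_eq_same, zero_add]
      · rw [Finsupp.add_apply, hν_def, Finsupp.erase_ne hl, Finsupp.single_eq_of_ne hl, add_zero]
    -- the layer `o_t + b` is inside the window `(q, 2q)`
    have hq0b : q < p₀ + b := by omega
    have h0b2 : p₀ + b < 2 * q := by omega
    -- the face identity at the layer `o_t + b`
    have hr : (W.st (t + 1)).r + μ = kept W t + ν + Finsupp.single (W.j t) (p₀ + b - q) := by
      rw [hr₁, hμeq, show p₀ + b - q = (p₀ - q) + b by omega, Finsupp.single_add]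
      abel
    have hcoefU : coeff ν (bPoly W t * resForm W t (p₀ + b)) ≠ 0 := by
      rw [← coeff_succ_layer hroot W t hq0b h0b2 hνj, ← hr]
      exact mem_support_iff.mp hm
    -- a componentwise-minimal index of `N_t(o_t + b)` below `ν`
    obtain ⟨νm, hνmle, hνmT, hνmUT⟩ := exists_minimal_index (bPoly W t) (resForm W t (p₀ + b))
      (by rw [coeff_zero_bPoly]; exact bUnit_ne_zero W t) hcoefU
    have hνmj : νm (W.j t) = 0 := by
      have := Finsupp.le_def.mp hνmle (W.j t); rw [hνj] at this; omega
    have hνmk : νm k ≤ μ k := by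
      have := Finsupp.le_def.mp hνmle k; rwa [hνk] at this
    -- back through the face identity: the monomial `M = kept_t + νm + (o_t + b − q) e_j` of `F_{t+1}`
    set M := kept W t + νm + Finsupp.single (W.j t) (p₀ + b - q) with hM
    have hMcoef : coeff M (W.st (t + 1)).F ≠ 0 := by
      rw [hM, coeff_succ_layer hroot W t hq0b h0b2 hνmj]
      exact hνmUT
    have hMmem : M ∈ (W.st (t + 1)).F.support := mem_support_iff.mpr hMcoef
    -- the layer degree of `νm`: `|νm| ≤ o_t + b − |r_t| = n + b`
    have hνmdeg : νm.degree ≤ p₀ + b - (W.st t).r.degree :=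
      degree_le_of_coeff_translate_resLayer_ne_zero (W.j t) (W.b t) (W.st t) (walk_r hroot W t) (p₀ + b) hνmT
    have hνmdeg3 : νm.degree = νm (W.j t) + νm (W.j (t + 1)) + νm k := degree_eq_three νm hne.symm hkj hki
    -- coordinates and degree of `M`
    have hkj0 : kept W t (W.j t) = 0 := kept_chart W t
    have hMj : M (W.j t) = p₀ + b - q := by
      rw [hM, Finsupp.add_apply, Finsupp.add_apply, hkj0, hνmj, Finsupp.single_eq_same, zero_add, zero_add]
    have hMi : M (W.j (t + 1)) = (W.st (t + 1)).r (W.j (t + 1)) + νm (W.j (t + 1)) := by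
      rw [hM, Finsupp.add_apply, Finsupp.add_apply, Finsupp.single_eq_of_ne hne, add_zero, hr₁, Finsupp.add_apply,
        Finsupp.single_eq_of_ne hne, add_zero]
    have hMdeg : M.degree = (kept W t).degree + νm.degree + (p₀ + b - q) := by
      rw [hM, map_add, map_add, Finsupp.degree_single]
    -- transport through the untranslated move `t+1` (chart `i`): the `u_j`-exponent of `M` lies in `(0, q)`
    have hP : ¬ IsPthPowerExponent q (chartExponent q (W.j (t + 1)) M) :=
      not_isPthPowerExponent_of_coord (W.j t) (by rw [chartExponent_apply_ne q hne.symm, hMj]; omega)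
        (by rw [chartExponent_apply_ne q hne.symm, hMj]; omega)
    have hc2 : coeff (chartExponent q (W.j (t + 1)) M) (W.st (t + 2)).F ≠ 0 := by
      rw [coeff_succ_of_untranslated hroot W (t + 1) hb hMmem hP]
      exact hMcoef
    have hdego₂ := le_degree_of_coeff_ne_zero ho₂ hc2
    have hce := degree_chartExponent_add q (W.j (t + 1)) (m := M) (le_degree_of_mem_support hroot W (t + 1) hMmem)
    -- bookkeeping: `νm_i + 2b + 2νm_k ≥ 2n`, `νm_i + νm_k ≤ n + b` ⇒ `n ≤ 3b + νm_k ≤ 3(q − 1 − corner)`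
    omega

/-- LAW J⁺ in the tree's letters (`StaysOnNewest W t`, `b_{t+1} = 0`). [new] [folklore] -/
theorem corner_bound_shade_of_stays (hroot : IsRoot q s₀) (W : ForcedWalk q s₀) (t : ℕ) {o₀ o₁ : ℕ}
    (ho₀ : ordZero (W.st t).F = o₀) (ho₁ : ordZero (W.st (t + 1)).F = o₁) (hq0 : q < o₀) (hq1 : q < o₁)
    (hplat : (W.st (t + 1)).shade = (W.st t).shade) (hplat' : (W.st (t + 2)).shade = (W.st (t + 1)).shade)
    {n : ℕ} (hn : (W.st t).shade = (n : ℕ∞)) (hS : StaysOnNewest W t) (hb : W.b (t + 1) = 0)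
    {k : Fin 3} (hki : k ≠ W.j (t + 1)) (hkj : k ≠ W.j t) :
    3 * ((W.st (t + 1)).r (W.j t) + (W.st (t + 1)).r k) + n + 3 ≤ 3 * q :=
  corner_bound_shade hroot W t ho₀ ho₁ hq0 hq1 hplat hplat' hn hS.1 hb hki hkj

/-- LAW J⁺ implies LAW J (`corner ≤ q − 2`) at every positive shade — a second, independent proof of g16's
law. [folklore] -/
theorem corner_bound_of_shade (hroot : IsRoot q s₀) (W : ForcedWalk q s₀) (t : ℕ) {o₀ o₁ : ℕ}
    (ho₀ : ordZero (W.st t).F = o₀) (ho₁ : ordZero (W.st (t + 1)).F = o₁) (hq0 : q < o₀) (hq1 : q < o₁)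
    (hplat : (W.st (t + 1)).shade = (W.st t).shade) (hplat' : (W.st (t + 2)).shade = (W.st (t + 1)).shade)
    {n : ℕ} (hn : (W.st t).shade = (n : ℕ∞)) (hn1 : 1 ≤ n) (hS : StaysOnNewest W t) (hb : W.b (t + 1) = 0)
    {k : Fin 3} (hki : k ≠ W.j (t + 1)) (hkj : k ≠ W.j t) :
    (W.st (t + 1)).r (W.j t) + (W.st (t + 1)).r k + 2 ≤ q := by
  have h := corner_bound_shade hroot W t ho₀ ho₁ hq0 hq1 hplat hplat' hn hS.1 hb hki hkj
  omega

end LawJPlus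

end Summit.ResolutionOfSingularities.ResolutionOfSingularities.Theorems.HoleCut
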